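import Summits.HodgeConjecture.HodgeCM.Model.ArchSlotBoxTorusType_1

/-! PORT of `HodgeCM/Model/ArchSlotBoxTorusType.lean` (HodgeCMPerL run 82) — part 2: continuation of `Summits.HodgeConjecture.HodgeCM.Model.ArchSlotBoxTorusType_1` (split at a top-level declaration boundary by port_pkg.py; scope re-opened below; declarations unchanged). -/

-- port_pkg: scope re-opened for this part (file-level context, then the namespace/section stack open at the cut)
set_option autoImplicit false
noncomputable section
open scoped Matrix Classical SchwartzMap TensorProduct ComplexConjugate
open MvPolynomial
open NumberField (InfinitePlace maximalRealSubfield IsCMField)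
open NumberField.mixedEmbedding (mixedSpace)
open Literature.NumberTheory.Automorphic Literature.NumberTheory.Automorphic.UnitaryGroup Literature.NumberTheory.Weil1964
open Literature.RepresentationTheory.KonnoKonno2007 Literature.RepresentationTheory.KonnoKonno2007.RealDualPair
open Literature.NumberTheory.GelbartRogawski1991 Literature.NumberTheory.GelbartRogawski1991.UnitaryDualPair
open Literature.RepresentationTheory (atPlace)
open Literature.Analysis.SegalBargmann
open HodgeCM.Adelic HodgeCM.PerL34 HodgeCM.Model.HypCensus
namespace HodgeCM.Model.ArchSideTerm
section Plane
variable {L : CMField} {ι₁ : L →+* ℂ} (V : HermSpace3 L ι₁) (S : StubTree.SeesawDatum L)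
variable (hGR : (cmSplittingDatum (L : Type) finProdFinEquiv (frameD V) (frameD_real V) (frameD_ne V) (dW S) (dW_real S) (dW_ne S)).CompatibleSplitting)
variable (h₁W : (∀ j, 0 < (ι₁ (dW S j)).re) ∨ ∀ j, (ι₁ (dW S j)).re < 0)
variable
  (hpos₀ : 0 < cmXW (L : Type) (frameD V) (lineVec (L : Type) (dW S 0)) (fun _ => dW_real S 0) ι₁ (HypCensus.cmPlace (L : Type) ι₁) 0)
  (hpos₁ : 0 < cmXW (L : Type) (frameD V) (lineVec (L : Type) (dW S 1)) (fun _ => dW_real S 1) ι₁ (HypCensus.cmPlace (L : Type) ι₁) 0)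
/-- **off `v₁` the `W`-signs of the pin are the true signs** `re w(v)(dW S j)` (`cmCW = 1` there). -/
theorem cmXW_pos_iff_of_ne {v : {v : InfinitePlace ↥(maximalRealSubfield (L : Type)) // v.IsReal}}
    (hv : v ≠ HypCensus.cmPlace (L : Type) ι₁) (j : Fin 2) :
    0 < cmXW (L : Type) (frameD V) (dW S) (dW_real S) ι₁ v j ↔ 0 < ((cmPlaceOver (L : Type) v).1.embedding (dW S j)).re := by
  have h : cmXW (L : Type) (frameD V) (dW S) (dW_real S) ι₁ v j = ((cmPlaceOver (L : Type) v).1.embedding (dW S j)).re := by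
    show placeSignVec (cmRealVec (L : Type) (dW S) (dW_real S)) (cmCW (L : Type) (frameD V) ι₁) v j = _
    rw [placeSignVec_cmRealVec (L : Type) v (cmPlaceOver (L : Type) v).1.embedding (comap_mk_embedding_cmPlaceOver (L : Type) v)
      (dW S) (dW_real S), cmCW, cmSignConv, if_neg (val_ne_comap_of_ne_cmPlace hv),
      div_self (im_embedding_cmPlaceOver_imagUnit_ne_zero (L : Type) v), div_one]
  rw [h]

include hpos₀ hpos₁ in
/-- **at `v₁` the two lines have the same true sign** (both are positive AS READ, and the reading divides by one non-zero constant). -/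
theorem re_dW_pos_iff_cmPlace :
    (0 < ((cmPlaceOver (L : Type) (HypCensus.cmPlace (L : Type) ι₁)).1.embedding (dW S 0)).re ↔
      0 < ((cmPlaceOver (L : Type) (HypCensus.cmPlace (L : Type) ι₁)).1.embedding (dW S 1)).re) := by
  have e : ∀ j, cmXW (L : Type) (frameD V) (dW S) (dW_real S) ι₁ (HypCensus.cmPlace (L : Type) ι₁) j =
      ((cmPlaceOver (L : Type) (HypCensus.cmPlace (L : Type) ι₁)).1.embedding (dW S j)).re /
        cmCW (L : Type) (frameD V) ι₁ (HypCensus.cmPlace (L : Type) ι₁) := fun j =>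
    placeSignVec_cmRealVec (L : Type) _ _ (comap_mk_embedding_cmPlaceOver (L : Type) _) (dW S) (dW_real S) _ j
  have h0 : 0 < cmXW (L : Type) (frameD V) (dW S) (dW_real S) ι₁ (HypCensus.cmPlace (L : Type) ι₁) 0 := hpos₀
  have h1 : 0 < cmXW (L : Type) (frameD V) (dW S) (dW_real S) ι₁ (HypCensus.cmPlace (L : Type) ι₁) 1 := hpos₁
  rw [e] at h0 h1
  rcases div_pos_iff.mp h0 with ⟨ha0, hc⟩ | ⟨ha0, hc⟩
  · exact iff_of_true ha0 ((div_pos_iff.mp h1).elim (fun h => h.1) fun h => absurd hc (not_lt.mpr h.2.le))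
  · exact iff_of_false (not_lt.mpr ha0.le)
      ((div_pos_iff.mp h1).elim (fun h => absurd hc (not_lt.mpr h.2.le)) fun h => not_lt.mpr h.1.le)

/-! ## §4 HEADLINE: the closed table -/

/-- **THE SLOT TABLE `δ_S : InfinitePlace L → ℤ`** — `V`-free and `ι₁`-free: `0` at a place where `re w(dW S 0)`, `re w(dW S 1)` have the
same sign; else `(+1 | −1) · (+3 | −3)`, `+1` iff line `1` is the positive one, `+3` iff `0 < im w(δ_L)` (`w(·) = w.embedding`). -/
def slotDelta (w : InfinitePlace (L : Type)) : ℤ :=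
  if (0 < (w.embedding (dW S 0)).re ↔ 0 < (w.embedding (dW S 1)).re) then 0
  else (if 0 < (w.embedding (dW S 1)).re then 1 else -1) * (if 0 < (w.embedding (imagUnit (L : Type))).im then 3 else -3)

include hpos₀ hpos₁ in
/-- the exponent expression of §3 IS the table entry. -/
theorem planeExp_eq_slotDelta (v : {v : InfinitePlace ↥(maximalRealSubfield (L : Type)) // v.IsReal}) :
    (if (0 < cmXW (L : Type) (frameD V) (dW S) (dW_real S) ι₁ v 0 ↔ 0 < cmXW (L : Type) (frameD V) (dW S) (dW_real S) ι₁ v 1)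
        then (0 : ℤ)
        else if 0 < cmXW (L : Type) (frameD V) (dW S) (dW_real S) ι₁ v 1 then
          (planeVacExponents V S hGR h₁W hpos₀ hpos₁ v).eR - (planeVacExponents V S hGR h₁W hpos₀ hpos₁ v).eS
        else (planeVacExponents V S hGR h₁W hpos₀ hpos₁ v).eS - (planeVacExponents V S hGR h₁W hpos₀ hpos₁ v).eR) =
      slotDelta S (cmPlaceOver (L : Type) v).1 := by
  by_cases hv : v = HypCensus.cmPlace (L : Type) ι₁
  · subst hv
    have hpos₀' : 0 < cmXW (L : Type) (frameD V) (dW S) (dW_real S) ι₁ (HypCensus.cmPlace (L : Type) ι₁) 0 := hpos₀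
    have hpos₁' : 0 < cmXW (L : Type) (frameD V) (dW S) (dW_real S) ι₁ (HypCensus.cmPlace (L : Type) ι₁) 1 := hpos₁
    rw [if_pos (iff_of_true hpos₀' hpos₁'), slotDelta, if_pos (re_dW_pos_iff_cmPlace V S hpos₀ hpos₁)]
  · rw [slotDelta]
    simp only [cmXW_pos_iff_of_ne V S hv]
    by_cases hiff : (0 < ((cmPlaceOver (L : Type) v).1.embedding (dW S 0)).re ↔ 0 < ((cmPlaceOver (L : Type) v).1.embedding (dW S 1)).re)
    · rw [if_pos hiff, if_pos hiff]
    · rw [if_neg hiff, if_neg hiff]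
      by_cases h1 : 0 < ((cmPlaceOver (L : Type) v).1.embedding (dW S 1)).re
      · have h0 : ¬0 < ((cmPlaceOver (L : Type) v).1.embedding (dW S 0)).re := fun h0 => hiff (iff_of_true h0 h1)
        rw [if_pos h1, if_pos h1, one_mul, planeVacExponents_eR_sub_eS V S hGR h₁W hpos₀ hpos₁ v
          ⟨1, (cmXW_pos_iff_of_ne V S hv 1).mpr h1⟩ ⟨0, fun h => h0 ((cmXW_pos_iff_of_ne V S hv 0).mp h)⟩,
          card_posIdx_sub_card_negIdx_cmXV_of_ne V hv]
      · have h0 : 0 < ((cmPlaceOver (L : Type) v).1.embedding (dW S 0)).re := by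
          by_contra h0; exact hiff (iff_of_false h0 h1)
        rw [if_neg h1, if_neg h1, neg_one_mul, ← neg_sub, planeVacExponents_eR_sub_eS V S hGR h₁W hpos₀ hpos₁ v
          ⟨0, (cmXW_pos_iff_of_ne V S hv 0).mpr h0⟩ ⟨1, fun h => h1 ((cmXW_pos_iff_of_ne V S hv 1).mp h)⟩,
          card_posIdx_sub_card_negIdx_cmXV_of_ne V hv]

/-- the real place under a place of `L`. -/
def placeBelow (w : InfinitePlace (L : Type)) : {v : InfinitePlace ↥(maximalRealSubfield (L : Type)) // v.IsReal} :=
  ⟨w.comap (algebraMap ↥(maximalRealSubfield (L : Type)) (L : Type)), NumberField.IsTotallyReal.isReal _⟩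

/-- every place of `L` is the chosen place over the place under it. -/
theorem cmPlaceOver_placeBelow (w : InfinitePlace (L : Type)) : (cmPlaceOver (L : Type) (placeBelow (L := L) w)).1 = w :=
  (cmPlaceOver_eq_mk (L : Type) _ w.embedding (by rw [NumberField.InfinitePlace.mk_embedding]; rfl)).trans
    (NumberField.InfinitePlace.mk_embedding w)

include hpos₀ hpos₁ in
/-- **(R-χ) HEADLINE — THE ANTIDIAGONAL TYPE OF binder-2's TORUS CHARACTER IN CLOSED FORM**:
`pinTorusType₁ w − pinTorusType₀ w = slotDelta S w` at every place `w` of `L`. -/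
theorem pinTorusType₁_sub_pinTorusType₀_apply (w : InfinitePlace (L : Type)) :
    pinTorusType₁ V S hGR h₁W w - pinTorusType₀ V S hGR h₁W w = slotDelta S w := by
  obtain ⟨v, rfl⟩ : ∃ v, (cmPlaceOver (L : Type) v).1 = w := ⟨placeBelow (L := L) w, cmPlaceOver_placeBelow w⟩
  rw [pinTorusType₁_sub_pinTorusType₀_cmPlaceOver V S hGR h₁W hpos₀ hpos₁, planeExp_eq_slotDelta V S hGR h₁W hpos₀ hpos₁]

include hpos₀ hpos₁ in
/-- the same as functions. -/
theorem pinTorusType₁_sub_pinTorusType₀ : pinTorusType₁ V S hGR h₁W - pinTorusType₀ V S hGR h₁W = slotDelta S :=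
  funext fun w => pinTorusType₁_sub_pinTorusType₀_apply V S hGR h₁W hpos₀ hpos₁ w

end Plane

/-! ## §5 The corollary for E: `hΔ₁` in closed form -/

section Vec

variable {L : CMField} {ι₁ : L →+* ℂ} (V : HermSpace3 L ι₁) (c : SeesawCtx L)
variable
  (hGR : (cmSplittingDatum (L : Type) finProdFinEquiv (frameD V) (frameD_real V) (frameD_ne V) (dW c.D) (dW_real c.D) (dW_ne c.D)).CompatibleSplitting)
  (hGR₀ : (cmSplittingDatum (L : Type) (e₁) (frameD V) (frameD_real V) (frameD_ne V) (lineVec (L : Type) (dW c.D 0))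
    (fun _ => dW_real c.D 0) (fun _ => dW_ne c.D 0)).CompatibleSplitting)
  (hGR₁ : (cmSplittingDatum (L : Type) (e₁) (frameD V) (frameD_real V) (frameD_ne V) (lineVec (L : Type) (dW c.D 1))
    (fun _ => dW_real c.D 1) (fun _ => dW_ne c.D 1)).CompatibleSplitting)
  (hGR₂ : (cmSplittingDatum (L : Type) (e₁) (frameD V) (frameD_real V) (frameD_ne V) (lineVec (L : Type) (dW' c.D 0))
    (fun _ => dW'_real c.D 0) (fun _ => dW'_ne c.D 0)).CompatibleSplitting)
  (hGR₃ : (cmSplittingDatum (L : Type) (e₁) (frameD V) (frameD_real V) (frameD_ne V) (lineVec (L : Type) (dW' c.D 1))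
    (fun _ => dW'_real c.D 1) (fun _ => dW'_ne c.D 1)).CompatibleSplitting)
  (h₁W : (∀ j, 0 < (ι₁ (dW c.D j)).re) ∨ ∀ j, (ι₁ (dW c.D j)).re < 0)
  (hpos₀ : 0 < cmXW (L : Type) (frameD V) (lineVec (L : Type) (dW c.D 0)) (fun _ => dW_real c.D 0) ι₁ (HypCensus.cmPlace (L : Type) ι₁) 0)
  (hpos₁ : 0 < cmXW (L : Type) (frameD V) (lineVec (L : Type) (dW c.D 1)) (fun _ => dW_real c.D 1) ι₁ (HypCensus.cmPlace (L : Type) ι₁) 0)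

include hpos₀ hpos₁ in
/-- **`hΔ₁` OF #1212 / glue-1 #395 IN CLOSED FORM**: `slotTypeVec 1 − slotTypeVec 0 = slotDelta c.D`
(E's `μ c 1 − μ c 0 := slotDelta c.D`: no `V`, no `ι₁`, no splitting, no `hc`). -/
theorem slotTypeVec_one_sub_zero_eq_slotDelta :
    slotTypeVec V c hGR hGR₀ hGR₁ hGR₂ hGR₃ h₁W 1 - slotTypeVec V c hGR hGR₀ hGR₁ hGR₂ hGR₃ h₁W 0 = slotDelta c.D := by
  rw [slotTypeVec_one_sub_zero_eq V c hGR hGR₀ hGR₁ hGR₂ hGR₃ h₁W hpos₀ hpos₁]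
  exact pinTorusType₁_sub_pinTorusType₀ V c.D hGR h₁W hpos₀ hpos₁

include hpos₀ hpos₁ in
/-- pointwise form at a place `w` of `L`. -/
theorem slotTypeVec_one_sub_zero_apply_eq_slotDelta (w : InfinitePlace (L : Type)) :
    slotTypeVec V c hGR hGR₀ hGR₁ hGR₂ hGR₃ h₁W 1 w - slotTypeVec V c hGR hGR₀ hGR₁ hGR₂ hGR₃ h₁W 0 w = slotDelta c.D w := by
  rw [slotTypeVec_one_sub_zero_apply V c hGR hGR₀ hGR₁ hGR₂ hGR₃ h₁W hpos₀ hpos₁ w]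
  exact pinTorusType₁_sub_pinTorusType₀_apply V c.D hGR h₁W hpos₀ hpos₁ w

end Vec

end HodgeCM.Model.ArchSideTerm

end
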